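import Literature.Probability.LatticeModels.MonotoneLimitStates
import Literature.Probability.LatticeModels.IsingVolumeMonotonicity
import Literature.Probability.LatticeModels.ButterflyPeriodicity
import HarnessLib

/-!
# The semi-infinite limit states `μ^{±}` above a horizontal line (Georgii–Higuchi 2000, §4)

Topic `Probability/LatticeModels`. Georgii–Higuchi, J. Math. Phys. 41 (2000), §4, eq. (2): for the
upper half-plane `π = {x₂ ≥ n}` the **semi-infinite limit**
`μ^±_n = lim_{Δ ↑ π} μ^{η±}_Δ` with boundary condition `η± = +1` on `π`, `-1` on `πᶜ`, "which
exists by stochastic monotonicity", "is a Gibbs measure on `π` with `-`boundary condition in `πᶜ`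
which is automatically invariant under horizontal translations"; and (proof of Lemma 4.2) the
shifted images `μ⁺_{n,-} = μ^±_{0} ∘ ϑ` with the wall at height `-n`, increasing in `n`. We
construct these states along the volumes `Δ_L = [-L, L] × [n, n+L]` and prove:

* `halfBoxMeasure`, `antitone_integral_halfBoxMeasure` — the finite-volume approximants decrease
  (FKG volume monotonicity, `isingExpect_fixed_anti_volume`);
* `upperPMState hβ n` — the limit (via `exists_limit_of_antitone`), with local convergence
  (`tendsto_integral_upperPMState`), domination by the approximants, the DLR equations in the
  half-plane (`isGibbsIn_upperPMState`), frozen `-`spins below the line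
  (`upperPMState_apply_eq_neg_one`);
* `upperPMState_map_shift_vert` — vertical shift covariance `μ^±_{n+m} = μ^±_n ∘ ϑ_{(0,m)}⁻¹`;
* `integral_upperPMState_mono_level` — lowering the wall increases the state (`μ^±_m ≼ μ^±_{m'}`
  for `m' ≤ m` on increasing local observables; GH: "`μ⁺_{n,-} ≺ μ⁺_{n+1,-}` by stochastic
  monotonicity", here from the DLR average `le_isingExpect_fixed_of_forall_le`);
* `upperPMState_map_shift_horiz` — horizontal translation invariance;
* `measure_eq_of_forall_integral_plusIndicator_eq` — the increasing indicators determine a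
  probability measure (tool).

## References

* H.-O. Georgii, Y. Higuchi, J. Math. Phys. 41 (2000), §4, eq. (2), Lemma 4.2 (proof)
  [GeorgiiHiguchi2000].
* S. Friedli, Y. Velenik, *Statistical Mechanics of Lattice Systems* (CUP 2017), §3.6.2,
  Lemma 3.22, Exercise 3.13; Lemma 6.7 [FriedliVelenik2017].
-/

noncomputable section

open MeasureTheory Filter Topology Finset
open Literature.Probability.Percolation

namespace Literature.Probability.LatticeModels

/-! ### Tools -/

/-- Spin products depend only on the spins in their index set. [folklore] -/
theorem dependsOn_spinProduct {V : Type*} (A : Finset V) : DependsOn (spinProduct A) (↑A : Set V) := by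
  intro σ τ hst
  unfold spinProduct spinAt
  exact Finset.prod_congr rfl fun x hx => by rw [hst x hx]

/-- **The increasing indicators determine a probability measure**: if `∫ n_S dρ₁ = ∫ n_S dρ₂` for
all finite `S`, then `ρ₁ = ρ₂` (spin products are combinations of the `n_S`, Friedli–Velenik 2017,
Lemma 3.19, and the correlations determine the measure). [cite: FriedliVelenik2017, Lemma 3.19] -/
theorem measure_eq_of_forall_integral_plusIndicator_eq {V : Type*} [DecidableEq V]
    (ρ₁ ρ₂ : Measure (SpinConfig V)) [IsProbabilityMeasure ρ₁] [IsProbabilityMeasure ρ₂]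
    (h : ∀ S : Finset V, ∫ σ, plusIndicator S σ ∂ρ₁ = ∫ σ, plusIndicator S σ ∂ρ₂) : ρ₁ = ρ₂ := by
  refine measure_eq_of_forall_spinCorr_eq ρ₁ ρ₂ fun A => ?_
  have hint : ∀ (ρ : Measure (SpinConfig V)) [IsProbabilityMeasure ρ] (S : Finset V),
      Integrable (plusIndicator S) ρ := fun ρ _ S =>
    Integrable.of_bound (measurable_plusIndicator S).aestronglyMeasurable 1
      (Eventually.of_forall fun σ => by
        rw [Real.norm_eq_abs, abs_of_nonneg (plusIndicator_nonneg S σ)]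
        exact plusIndicator_le_one' S σ)
  have hexp : ∀ (ρ : Measure (SpinConfig V)) [IsProbabilityMeasure ρ], spinCorr ρ A =
      ∑ B ∈ A.powerset, ((-1 : ℝ) ^ #(A \ B) * 2 ^ #B) * ∫ σ, plusIndicator B σ ∂ρ := by
    intro ρ _
    rw [spinCorr, show (fun σ => spinProduct A σ) = fun σ => ∑ B ∈ A.powerset,
      ((-1 : ℝ) ^ #(A \ B) * 2 ^ #B) * plusIndicator B σ from funext (spinProduct_eq_sum_plusIndicator A),
      integral_finsetSum _ fun B _ => (hint ρ B).const_mul _]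
    exact Finset.sum_congr rfl fun B _ => integral_const_mul _ _
  rw [hexp ρ₁, hexp ρ₂]
  exact Finset.sum_congr rfl fun B _ => by rw [h B]

/-- Local observables stay local under translations: `F ∘ T_v` depends on `D - v`. [folklore] -/
theorem DependsOn.comp_configRelabel_shift {d : ℕ} {F : SpinConfig (Site d) → ℝ} {D : Finset (Site d)}
    (hF : DependsOn F (↑D : Set (Site d))) (v : Site d) :
    DependsOn (F ∘ configRelabel (Site.shift v)) (↑(D.image fun x => x - v) : Set (Site d)) := by
  intro σ τ hst
  simp only [Function.comp_apply]
  refine hF fun x hx => ?_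
  rw [configRelabel_shift_apply, configRelabel_shift_apply]
  exact hst (x - v) (by rw [Finset.coe_image]; exact Set.mem_image_of_mem _ hx)

/-- The finite-volume Gibbs distribution with boundary condition `η` is carried by the configurations
equal to `η` off `Λ` (tree fact `isingMeasure_range_glue`). [cite: FriedliVelenik2017, §3.1] -/
theorem isingMeasure_fixed_apply_eq_outside {V : Type*} [DecidableEq V] (G : SimpleGraph V) [G.LocallyFinite]
    (Λ : Finset V) (β h : ℝ) (η : SpinConfig V) {x : V} (hx : x ∉ Λ) :
    isingMeasure G Λ β h (.fixed η) {σ | σ x = η x} = 1 := by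
  have h1 := isingMeasure_range_glue_holds G Λ β h (.fixed η)
  have hsub : Set.range (fun τ : Λ → ℤˣ => glue Λ τ (.fixed η)) ⊆ {σ : SpinConfig V | σ x = η x} := by
    rintro _ ⟨τ, rfl⟩
    simp [hx]
  exact le_antisymm prob_le_one (h1.symm.le.trans (measure_mono hsub))

/-! ### Half-planes, boundary conditions and volumes -/

/-- The upper half-plane `π_n = {x : x₂ ≥ n}` of `ℤ²`. [cite: GeorgiiHiguchi2000, §2 p. 3] -/
def halfPlane (n : ℤ) : Set (Site 2) := {x | n ≤ x 1}

/-- The boundary condition `η^±_n`: `+1` on `π_n`, `-1` below. [cite: GeorgiiHiguchi2000, §4 eq. (2)] -/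
def pmBC (n : ℤ) : SpinConfig (Site 2) := fun x => if n ≤ x 1 then 1 else -1

/-- The volumes `Δ_L = [-L, L] × [n, n + L] ⊆ π_n`. [cite: GeorgiiHiguchi2000, §4 eq. (2)] -/
def halfBox (n : ℤ) (L : ℕ) : Finset (Site 2) :=
  (box 2 (L + n.natAbs)).filter fun x => |x 0| ≤ L ∧ n ≤ x 1 ∧ x 1 ≤ n + L

/-- Membership in `Δ_L`. [folklore] -/
theorem mem_halfBox {n : ℤ} {L : ℕ} {x : Site 2} :
    x ∈ halfBox n L ↔ |x 0| ≤ L ∧ n ≤ x 1 ∧ x 1 ≤ n + L := by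
  rw [halfBox, Finset.mem_filter, mem_box]
  constructor
  · exact fun h => h.2
  · rintro ⟨h0, h1, h2⟩
    refine ⟨fun i => ?_, h0, h1, h2⟩
    have habs : (n.natAbs : ℤ) = |n| := Int.natCast_natAbs n
    rw [abs_le] at h0
    fin_cases i
    · simp only [Nat.cast_add, habs]
      change -(↑L + |n|) ≤ x 0 ∧ x 0 ≤ ↑L + |n|
      constructor <;> linarith [abs_nonneg n]
    · simp only [Nat.cast_add, habs]
      change -(↑L + |n|) ≤ x 1 ∧ x 1 ≤ ↑L + |n|
      constructor <;> linarith [neg_abs_le n, le_abs_self n]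

/-- `Δ_L ⊆ π_n`. [folklore] -/
theorem coe_halfBox_subset_halfPlane (n : ℤ) (L : ℕ) : (↑(halfBox n L) : Set (Site 2)) ⊆ halfPlane n :=
  fun _ hx => (mem_halfBox.1 (Finset.mem_coe.1 hx)).2.1

/-- `Δ_L` increases with `L`. [folklore] -/
theorem halfBox_mono (n : ℤ) : Monotone (halfBox n) := by
  intro L L' hLL' x hx
  rw [mem_halfBox] at hx ⊢
  have : (L : ℤ) ≤ L' := by exact_mod_cast hLL'
  exact ⟨hx.1.trans this, hx.2.1, hx.2.2.trans (by linarith)⟩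

/-- The volumes `Δ_L` exhaust `π_n`. [folklore] -/
theorem exists_subset_halfBox {n : ℤ} (Λ : Finset (Site 2)) (hΛ : (↑Λ : Set (Site 2)) ⊆ halfPlane n) :
    ∃ L₀, ∀ L, L₀ ≤ L → Λ ⊆ halfBox n L := by
  obtain ⟨L₁, hL₁⟩ := exists_forall_subset_box 2 Λ
  refine ⟨L₁ + n.natAbs, fun L hL x hx => ?_⟩
  have hxb := mem_box.1 (hL₁ L₁ le_rfl hx)
  have hxn : n ≤ x 1 := hΛ (Finset.mem_coe.2 hx)
  rw [mem_halfBox]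
  have h0 := hxb 0; have h1 := hxb 1
  have hL' : (L₁ : ℤ) + n.natAbs ≤ L := by exact_mod_cast hL
  have habs : (n.natAbs : ℤ) = |n| := Int.natCast_natAbs n
  refine ⟨abs_le.2 ⟨by linarith, by linarith⟩, hxn, ?_⟩
  rw [habs] at hL'
  linarith [neg_abs_le n, h1.2]

/-- `η^±_n ≡ +1` on `π_n`. [folklore] -/
theorem pmBC_of_le {n : ℤ} {x : Site 2} (hx : n ≤ x 1) : pmBC n x = 1 := by
  simp [pmBC, hx]

/-- `η^±_n ≡ -1` below `π_n`. [folklore] -/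
theorem pmBC_of_lt {n : ℤ} {x : Site 2} (hx : x 1 < n) : pmBC n x = -1 := by
  simp [pmBC, not_le.2 hx]

/-- `η^±_m ≤ η^±_{m'}` for `m' ≤ m`. [folklore] -/
theorem pmBC_anti {m m' : ℤ} (h : m' ≤ m) : pmBC m ≤ pmBC m' := by
  intro x
  by_cases hx : m ≤ x 1
  · rw [pmBC_of_le hx, pmBC_of_le (h.trans hx)]
  · rw [pmBC_of_lt (not_le.1 hx)]
    exact neg_one_le_intUnits _

variable {β : ℝ}

/-- The finite-volume approximants `μ^{η±_n}_{Δ_L;β,0}`. [cite: GeorgiiHiguchi2000, §4 eq. (2)] -/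
def halfBoxMeasure (β : ℝ) (n : ℤ) (L : ℕ) : Measure (SpinConfig (Site 2)) :=
  isingMeasure (zdGraph 2) (halfBox n L) β 0 (.fixed (pmBC n))

/-- The approximants are probability measures. [folklore] -/
instance (β : ℝ) (n : ℤ) (L : ℕ) : IsProbabilityMeasure (halfBoxMeasure β n L) := by
  unfold halfBoxMeasure; infer_instance

/-- **Stochastic monotonicity of the approximants**: for `β ≥ 0` the expectations of increasing local
observables decrease along `Δ_L ↑ π_n` (Friedli–Velenik Lemma 3.22 with `+` boundary spins on the
added sites). [cite: GeorgiiHiguchi2000, §4 eq. (2)] -/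
theorem antitone_integral_halfBoxMeasure (hβ : 0 ≤ β) (n : ℤ) {f : SpinConfig (Site 2) → ℝ}
    (hf : Monotone f) (hfm : Measurable f) :
    Antitone fun L => ∫ σ, f σ ∂(halfBoxMeasure β n L) := by
  refine antitone_nat_of_succ_le fun L => ?_
  change isingExpect (zdGraph 2) (halfBox n (L + 1)) β 0 (.fixed (pmBC n)) f ≤
    isingExpect (zdGraph 2) (halfBox n L) β 0 (.fixed (pmBC n)) f
  refine isingExpect_fixed_anti_volume (zdGraph 2) hβ (halfBox_mono n (Nat.le_succ L)) 0
    (fun x hx => pmBC_of_le ?_) hf hfm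
  exact (mem_halfBox.1 (Finset.mem_sdiff.1 hx).1).2.1

/-- Existence of the semi-infinite limit with its two defining properties. [cite: GeorgiiHiguchi2000, §4 eq. (2)] -/
theorem exists_upperPMState (hβ : 0 ≤ β) (n : ℤ) :
    ∃ μ : Measure (SpinConfig (Site 2)), IsProbabilityMeasure μ ∧
      (∀ (D : Finset (Site 2)) (F : SpinConfig (Site 2) → ℝ), DependsOn F (↑D : Set (Site 2)) →
        Tendsto (fun L => ∫ σ, F σ ∂(halfBoxMeasure β n L)) atTop (𝓝 (∫ σ, F σ ∂μ))) ∧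
      ∀ (D : Finset (Site 2)) (f : SpinConfig (Site 2) → ℝ), DependsOn f (↑D : Set (Site 2)) →
        Monotone f → Measurable f → (∀ σ, |f σ| ≤ 1) →
          ∀ L, ∫ σ, f σ ∂μ ≤ ∫ σ, f σ ∂(halfBoxMeasure β n L) :=
  exists_limit_of_antitone _ fun _ _ _ hf hfm _ => antitone_integral_halfBoxMeasure hβ n hf hfm

/-- **The semi-infinite limit state `μ^±_n = lim_{Δ↑π_n} μ^{η±_n}_Δ`** (Georgii–Higuchi 2000, §4,
eq. (2)), at inverse temperature `β ≥ 0` and `h = 0`. [cite: GeorgiiHiguchi2000, §4 eq. (2)] -/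
def upperPMState (hβ : 0 ≤ β) (n : ℤ) : Measure (SpinConfig (Site 2)) :=
  (exists_upperPMState hβ n).choose

/-- The semi-infinite state is a probability measure. [folklore] -/
instance (hβ : 0 ≤ β) (n : ℤ) : IsProbabilityMeasure (upperPMState hβ n) :=
  (exists_upperPMState hβ n).choose_spec.1

/-- Local expectations converge to the semi-infinite state. [cite: GeorgiiHiguchi2000, §4 eq. (2)] -/
theorem tendsto_integral_upperPMState (hβ : 0 ≤ β) (n : ℤ) {D : Finset (Site 2)}
    {F : SpinConfig (Site 2) → ℝ} (hF : DependsOn F (↑D : Set (Site 2))) :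
    Tendsto (fun L => ∫ σ, F σ ∂(halfBoxMeasure β n L)) atTop (𝓝 (∫ σ, F σ ∂(upperPMState hβ n))) :=
  (exists_upperPMState hβ n).choose_spec.2.1 D F hF

/-- The semi-infinite state is dominated by each approximant on increasing local observables. [cite: GeorgiiHiguchi2000, §4 eq. (2)] -/
theorem integral_upperPMState_le (hβ : 0 ≤ β) (n : ℤ) {D : Finset (Site 2)}
    {f : SpinConfig (Site 2) → ℝ} (hfD : DependsOn f (↑D : Set (Site 2))) (hf : Monotone f)
    (hfm : Measurable f) (hfb : ∀ σ, |f σ| ≤ 1) (L : ℕ) :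
    ∫ σ, f σ ∂(upperPMState hβ n) ≤ ∫ σ, f σ ∂(halfBoxMeasure β n L) :=
  (exists_upperPMState hβ n).choose_spec.2.2 D f hfD hf hfm hfb L

/-- **`μ^±_n` is a Gibbs measure on `π_n`** (DLR equations for all finite `Λ ⊆ π_n`). [cite: GeorgiiHiguchi2000, §4 (after eq. (2))] -/
theorem isGibbsIn_upperPMState (hβ : 0 ≤ β) (n : ℤ) :
    IsGibbsIn (halfPlane n) (isingSpecification (zdGraph 2) β 0) (upperPMState hβ n) := by
  refine isGibbsIn_isingSpecification_of_tendsto _ (halfBoxMeasure β n) _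
    (fun D F hF => tendsto_integral_upperPMState hβ n hF) fun Λ hΛ A hA => ?_
  obtain ⟨L₀, hL₀⟩ := exists_subset_halfBox Λ hΛ
  filter_upwards [eventually_ge_atTop L₀] with L hL
  exact (isGibbsIn_isingMeasure_fixed (zdGraph 2) (halfBox n L) β 0 (pmBC n)).2 Λ
    (Finset.coe_subset.2 (hL₀ L hL)) A hA

/-- **`-`boundary condition below the line**: `μ^±_n{σ_x = -1} = 1` for `x₂ < n`. [cite: GeorgiiHiguchi2000, §4 (after eq. (2))] -/
theorem upperPMState_apply_eq_neg_one (hβ : 0 ≤ β) {n : ℤ} {x : Site 2} (hx : x 1 < n) :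
    upperPMState hβ n {σ | σ x = -1} = 1 := by
  refine measure_apply_eq_one_of_tendsto (halfBoxMeasure β n) _
    (fun D F hF => tendsto_integral_upperPMState hβ n hF) x (-1) (Eventually.of_forall fun L => ?_)
  have hxL : x ∉ halfBox n L := fun h => not_le.2 hx (mem_halfBox.1 h).2.1
  have := isingMeasure_fixed_apply_eq_outside (zdGraph 2) (halfBox n L) β 0 (pmBC n) hxL
  rwa [pmBC_of_lt hx] at this

/-! ### Vertical shift covariance -/

/-- The vertical vector `(0, m)`. [folklore] -/
def vert (m : ℤ) : Site 2 := ![0, m]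

/-- First coordinate of `(0, m)`. [folklore] -/
@[simp] theorem vert_apply_zero (m : ℤ) : vert m 0 = 0 := rfl

/-- Second coordinate of `(0, m)`. [folklore] -/
@[simp] theorem vert_apply_one (m : ℤ) : vert m 1 = m := rfl

/-- `vert (a + b) = vert a + vert b`. [folklore] -/
theorem vert_add (a b : ℤ) : vert (a + b) = vert a + vert b := by
  ext i; fin_cases i <;> simp [vert]

/-- Translating the volume: `Δ_L(n) + (0,m) = Δ_L(n+m)`. [folklore] -/
theorem halfBox_map_shift_vert (n m : ℤ) (L : ℕ) :
    (halfBox n L).map (zdShiftIso (vert m)).toEquiv.toEmbedding = halfBox (n + m) L := by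
  ext y
  rw [mem_map_toEmbedding_iff, mem_halfBox, mem_halfBox]
  change (|(y - vert m) 0| ≤ L ∧ n ≤ (y - vert m) 1 ∧ (y - vert m) 1 ≤ n + L) ↔ _
  simp only [Pi.sub_apply, vert_apply_zero, vert_apply_one, sub_zero]
  constructor
  · rintro ⟨h0, h1, h2⟩; exact ⟨h0, by linarith, by linarith⟩
  · rintro ⟨h0, h1, h2⟩; exact ⟨h0, by linarith, by linarith⟩

/-- Translating the boundary condition: `η^±_n ∘ ϑ_{(0,m)}⁻¹ = η^±_{n+m}`. [folklore] -/
theorem configRelabel_shift_vert_pmBC (n m : ℤ) :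
    configRelabel (Site.shift (vert m)) (pmBC n) = pmBC (n + m) := by
  funext x
  rw [configRelabel_shift_apply]
  by_cases hx : n + m ≤ x 1
  · rw [pmBC_of_le hx, pmBC_of_le]
    simp only [Pi.sub_apply, vert_apply_one]; linarith
  · rw [pmBC_of_lt (not_le.1 hx), pmBC_of_lt]
    simp only [Pi.sub_apply, vert_apply_one]; linarith [not_le.1 hx]

/-- The approximants are shift covariant: `μ^{η±_n}_{Δ_L(n)} ∘ ϑ⁻¹ = μ^{η±_{n+m}}_{Δ_L(n+m)}`. [cite: FriedliVelenik2017, §3.1] -/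
theorem halfBoxMeasure_map_shift_vert (β : ℝ) (n m : ℤ) (L : ℕ) :
    (halfBoxMeasure β n L).map (configRelabel (Site.shift (vert m))) = halfBoxMeasure β (n + m) L := by
  have h := isingMeasure_fixed_map_relabel (zdGraph 2) (zdShiftIso (vert m)) (halfBox n L) β 0 (pmBC n)
  rw [halfBox_map_shift_vert] at h
  have he : (zdShiftIso (vert m)).toEquiv = Site.shift (vert m) := rfl
  rw [he, configRelabel_shift_vert_pmBC] at h
  exact h

/-- **Vertical shift covariance of the semi-infinite states**: `μ^±_{n+m} = μ^±_n ∘ ϑ_{(0,m)}⁻¹`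
(GH: `μ⁺_{n,-} = μ^±_up ∘ ϑ`). [cite: GeorgiiHiguchi2000, Lemma 4.2 (proof)] -/
theorem upperPMState_map_shift_vert (hβ : 0 ≤ β) (n m : ℤ) :
    (upperPMState hβ n).map (configRelabel (Site.shift (vert m))) = upperPMState hβ (n + m) := by
  classical
  set T := configRelabel (Site.shift (vert m)) with hT
  haveI : IsProbabilityMeasure ((upperPMState hβ n).map T) :=
    Measure.isProbabilityMeasure_map T.measurable.aemeasurable
  refine measure_eq_of_forall_integral_plusIndicator_eq _ _ fun S => ?_
  rw [integral_map_equiv]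
  have h1 : Tendsto (fun L => ∫ σ, plusIndicator S (T σ) ∂(halfBoxMeasure β n L)) atTop
      (𝓝 (∫ σ, plusIndicator S (T σ) ∂(upperPMState hβ n))) :=
    tendsto_integral_upperPMState hβ n (DependsOn.comp_configRelabel_shift (dependsOn_plusIndicator' S) (vert m))
  have h2 : Tendsto (fun L => ∫ σ, plusIndicator S (T σ) ∂(halfBoxMeasure β n L)) atTop
      (𝓝 (∫ σ, plusIndicator S σ ∂(upperPMState hβ (n + m)))) := by
    have h3 : ∀ L, ∫ σ, plusIndicator S (T σ) ∂(halfBoxMeasure β n L) =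
        ∫ σ, plusIndicator S σ ∂(halfBoxMeasure β (n + m) L) := by
      intro L
      rw [← halfBoxMeasure_map_shift_vert β n m L, integral_map_equiv]
    simp_rw [h3]
    exact tendsto_integral_upperPMState hβ (n + m) (dependsOn_plusIndicator' S)
  exact tendsto_nhds_unique h1 h2

/-! ### Lowering the wall increases the state -/

/-- **Stochastic monotonicity in the level**: for `m' ≤ m` and an increasing local observable `f`,
`∫ f dμ^±_m ≤ ∫ f dμ^±_{m'}` (GH, proof of Lemma 4.2: "`μ⁺_{n,-} ≺ μ⁺_{n+1,-}` by stochastic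
monotonicity"). Proof: `μ^±_m(f) ≤ μ^{η_m}_{Δ_L(m)}(f) ≤ μ^{η_m}_{Δ'}(f)` for
`Δ' = Δ_L(m') ∩ π_m` (volume monotonicity with `+` spins on the difference), and
`μ^{η_m}_{Δ'}(f) ≤ μ^{η_{m'}}_{Δ_L(m')}(f)` because the latter is an average of `μ^{ζ}_{Δ'}(f)`
over boundary conditions `ζ ≥ η_m` (`le_isingExpect_fixed_of_forall_le`, FKG in the boundary
condition). [cite: GeorgiiHiguchi2000, Lemma 4.2 (proof)] -/
theorem integral_upperPMState_mono_level (hβ : 0 ≤ β) {m m' : ℤ} (hmm : m' ≤ m) {D : Finset (Site 2)}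
    {f : SpinConfig (Site 2) → ℝ} (hfD : DependsOn f (↑D : Set (Site 2))) (hf : Monotone f)
    (hfm : Measurable f) (hfb : ∀ σ, |f σ| ≤ 1) :
    ∫ σ, f σ ∂(upperPMState hβ m) ≤ ∫ σ, f σ ∂(upperPMState hβ m') := by
  refine ge_of_tendsto (tendsto_integral_upperPMState hβ m' hfD) (Eventually.of_forall fun L => ?_)
  -- `Δ' = Δ_L(m') ∩ π_m ⊆ Δ_L(m)`
  set Δ' : Finset (Site 2) := (halfBox m' L).filter fun x => m ≤ x 1 with hΔ'
  have hsub1 : Δ' ⊆ halfBox m L := by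
    intro x hx
    rw [hΔ', Finset.mem_filter, mem_halfBox] at hx
    rw [mem_halfBox]
    exact ⟨hx.1.1, hx.2, by linarith [hx.1.2.2]⟩
  have hsub2 : Δ' ⊆ halfBox m' L := Finset.filter_subset _ _
  calc ∫ σ, f σ ∂(upperPMState hβ m)
      ≤ ∫ σ, f σ ∂(halfBoxMeasure β m L) := integral_upperPMState_le hβ m hfD hf hfm hfb L
    _ ≤ isingExpect (zdGraph 2) Δ' β 0 (.fixed (pmBC m)) f := by
        change isingExpect (zdGraph 2) (halfBox m L) β 0 (.fixed (pmBC m)) f ≤ _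
        exact isingExpect_fixed_anti_volume (zdGraph 2) hβ hsub1 0
          (fun x hx => pmBC_of_le (mem_halfBox.1 (Finset.mem_sdiff.1 hx).1).2.1) hf hfm
    _ ≤ ∫ σ, f σ ∂(halfBoxMeasure β m' L) := by
        change _ ≤ isingExpect (zdGraph 2) (halfBox m' L) β 0 (.fixed (pmBC m')) f
        refine le_isingExpect_fixed_of_forall_le (zdGraph 2) hsub2 (pmBC m') β 0 hfm fun τ₂ => ?_
        refine isingExpect_fixed_mono (zdGraph 2) hβ Δ' 0 (fun x => ?_) hf hfm
        by_cases hx : x ∈ halfBox m' L \ Δ'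
        · rw [glue_apply_of_mem _ _ _ hx]
          have hxm : x 1 < m := by
            by_contra hle
            exact (Finset.mem_sdiff.1 hx).2 (Finset.mem_filter.2 ⟨(Finset.mem_sdiff.1 hx).1, not_lt.1 hle⟩)
          rw [pmBC_of_lt hxm]
          exact neg_one_le_intUnits _
        · rw [glue_apply_of_notMem _ _ _ hx, BoundaryCondition.outside_fixed]
          exact pmBC_anti hmm x

/-! ### Horizontal translation invariance -/

/-- The horizontal vector `(a, 0)`. [folklore] -/
def horiz (a : ℤ) : Site 2 := ![a, 0]

/-- First coordinate of `(a, 0)`. [folklore] -/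
@[simp] theorem horiz_apply_zero (a : ℤ) : horiz a 0 = a := rfl

/-- Second coordinate of `(a, 0)`. [folklore] -/
@[simp] theorem horiz_apply_one (a : ℤ) : horiz a 1 = 0 := rfl

/-- `η^±_n` is invariant under horizontal translations. [folklore] -/
theorem configRelabel_shift_horiz_pmBC (n a : ℤ) :
    configRelabel (Site.shift (horiz a)) (pmBC n) = pmBC n := by
  funext x
  rw [configRelabel_shift_apply]
  simp only [pmBC, Pi.sub_apply, horiz_apply_one, sub_zero]

/-- The horizontally translated volume is sandwiched: `Δ_L ⊆ Δ_{L}(n) + (1,0) ⊆ Δ_{L+1}` fails at the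
left edge, but `Δ_{L} ⊆ Δ_{L+1} + (1, 0) ⊆ Δ_{L+2}`. [folklore] -/
theorem halfBox_subset_map_shift_horiz (n : ℤ) (L : ℕ) :
    halfBox n L ⊆ (halfBox n (L + 1)).map (zdShiftIso (horiz 1)).toEquiv.toEmbedding ∧
      (halfBox n (L + 1)).map (zdShiftIso (horiz 1)).toEquiv.toEmbedding ⊆ halfBox n (L + 2) := by
  constructor
  · intro y hy
    rw [mem_map_toEmbedding_iff, mem_halfBox]
    rw [mem_halfBox] at hy
    change |(y - horiz 1) 0| ≤ ↑(L + 1) ∧ n ≤ (y - horiz 1) 1 ∧ (y - horiz 1) 1 ≤ n + ↑(L + 1)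
    simp only [Pi.sub_apply, horiz_apply_zero, horiz_apply_one, sub_zero]
    push_cast
    rw [abs_le] at hy ⊢
    exact ⟨⟨by linarith [hy.1.1], by linarith [hy.1.2]⟩, hy.2.1, by linarith [hy.2.2]⟩
  · intro y hy
    rw [mem_map_toEmbedding_iff, mem_halfBox] at hy
    rw [mem_halfBox]
    change |(y - horiz 1) 0| ≤ ↑(L + 1) ∧ n ≤ (y - horiz 1) 1 ∧ (y - horiz 1) 1 ≤ n + ↑(L + 1) at hy
    simp only [Pi.sub_apply, horiz_apply_zero, horiz_apply_one, sub_zero] at hy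
    push_cast at hy ⊢
    rw [abs_le] at hy ⊢
    exact ⟨⟨by linarith [hy.1.1], by linarith [hy.1.2]⟩, hy.2.1, by linarith [hy.2.2]⟩

/-- **`μ^±_n` is invariant under horizontal translations** (GH §4: "automatically invariant under
horizontal translations"): the translated approximants are sandwiched between approximants. [cite: GeorgiiHiguchi2000, §4 (after eq. (2))] -/
theorem upperPMState_map_shift_horiz_one (hβ : 0 ≤ β) (n : ℤ) :
    (upperPMState hβ n).map (configRelabel (Site.shift (horiz 1))) = upperPMState hβ n := by
  classical
  set T := configRelabel (Site.shift (horiz 1)) with hT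
  haveI : IsProbabilityMeasure ((upperPMState hβ n).map T) :=
    Measure.isProbabilityMeasure_map T.measurable.aemeasurable
  refine measure_eq_of_forall_integral_plusIndicator_eq _ _ fun S => ?_
  rw [integral_map_equiv]
  -- `∫ n_S ∘ T dμ^±_n = lim_L ∫ n_S ∘ T dν_L = lim_L ∫ n_S d(ν_L ∘ T⁻¹)`
  have h1 : Tendsto (fun L => ∫ σ, plusIndicator S (T σ) ∂(halfBoxMeasure β n L)) atTop
      (𝓝 (∫ σ, plusIndicator S (T σ) ∂(upperPMState hβ n))) :=
    tendsto_integral_upperPMState hβ n (DependsOn.comp_configRelabel_shift (dependsOn_plusIndicator' S) (horiz 1))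
  -- the translated approximant in `Δ_{L+1}` is sandwiched between `ν_{L+2}` and `ν_L`
  set ρ : ℕ → Measure (SpinConfig (Site 2)) := fun L =>
    isingMeasure (zdGraph 2) ((halfBox n (L + 1)).map (zdShiftIso (horiz 1)).toEquiv.toEmbedding) β 0
      (.fixed (pmBC n)) with hρ
  have hρeq : ∀ L, (halfBoxMeasure β n (L + 1)).map T = ρ L := by
    intro L
    have h := isingMeasure_fixed_map_relabel (zdGraph 2) (zdShiftIso (horiz 1)) (halfBox n (L + 1)) β 0 (pmBC n)
    have he : (zdShiftIso (horiz 1)).toEquiv = Site.shift (horiz 1) := rfl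
    rw [he, configRelabel_shift_horiz_pmBC] at h
    exact h
  have hlow : ∀ L, ∫ σ, plusIndicator S σ ∂(halfBoxMeasure β n (L + 2)) ≤ ∫ σ, plusIndicator S σ ∂(ρ L) :=
    fun L => isingExpect_fixed_anti_volume (zdGraph 2) hβ (halfBox_subset_map_shift_horiz n L).2 0
      (fun x hx => pmBC_of_le (mem_halfBox.1 (Finset.mem_sdiff.1 hx).1).2.1)
      (plusIndicator_mono S) (measurable_plusIndicator S)
  have hup : ∀ L, ∫ σ, plusIndicator S σ ∂(ρ L) ≤ ∫ σ, plusIndicator S σ ∂(halfBoxMeasure β n L) := by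
    intro L
    refine isingExpect_fixed_anti_volume (zdGraph 2) hβ (halfBox_subset_map_shift_horiz n L).1 0
      (fun x hx => pmBC_of_le ?_) (plusIndicator_mono S) (measurable_plusIndicator S)
    have hx' := (Finset.mem_sdiff.1 hx).1
    rw [mem_map_toEmbedding_iff, mem_halfBox] at hx'
    have : n ≤ (x - horiz 1) 1 := hx'.2.1
    simpa using this
  have hlim := tendsto_integral_upperPMState hβ n (dependsOn_plusIndicator' S)
  have hlim2 : Tendsto (fun L => ∫ σ, plusIndicator S σ ∂(halfBoxMeasure β n (L + 2))) atTop
      (𝓝 (∫ σ, plusIndicator S σ ∂(upperPMState hβ n))) := (tendsto_add_atTop_iff_nat 2).2 hlim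
  have hρlim : Tendsto (fun L => ∫ σ, plusIndicator S σ ∂(ρ L)) atTop
      (𝓝 (∫ σ, plusIndicator S σ ∂(upperPMState hβ n))) :=
    tendsto_of_tendsto_of_tendsto_of_le_of_le hlim2 hlim hlow hup
  have h1' : Tendsto (fun L => ∫ σ, plusIndicator S (T σ) ∂(halfBoxMeasure β n (L + 1))) atTop
      (𝓝 (∫ σ, plusIndicator S (T σ) ∂(upperPMState hβ n))) := (tendsto_add_atTop_iff_nat 1).2 h1
  have h4 : ∀ L, ∫ σ, plusIndicator S (T σ) ∂(halfBoxMeasure β n (L + 1)) = ∫ σ, plusIndicator S σ ∂(ρ L) := by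
    intro L
    rw [← hρeq L, integral_map_equiv]
  simp_rw [h4] at h1'
  exact tendsto_nhds_unique h1' hρlim

end Literature.Probability.LatticeModels
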